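import Literature.NumberTheory.Automorphic.LocalLanglandsGLOne
import Literature.NumberTheory.Automorphic.LocalLanglandsDatum
import HarnessLib

/-!
# The degree `≤ 1` maps of a local Langlands datum are local class field theory

Topic `Literature/NumberTheory/Automorphic`; theorems only (no definitions, no named facts), sibling of
`LocalLanglandsDatum` (the bundled local Langlands correspondence `LocalLanglandsDatum F`,
Harris–Taylor 2001, Thm. A; Henniart 2000, Thm. 1.2) and of `LocalLanglandsGLOne` (the reciprocity map
`recGLOne hns d : Irr(GL₁(F)) → {1-dimensional Frobenius-semisimple Weil–Deligne representations}/≅`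
of local class field theory, and `recGLZero`, together with the theorem that every family `rec` with
`IsLocalLanglandsGL F … d 𝓔 rec` has `rec 1 = recGLOne hns d`, `rec 0 = recGLZero`).

Specialised to a datum `L : LocalLanglandsDatum F`: `L.recGL 1 = recGLOne L.hns L.artin`,
`L.recGL 0 = recGLZero`, and `L.recGL 1 [π] = [(χ ∘ artin, 0)]` for `π = χ ∘ det`
(Harris–Taylor 2001, Thm. A (i): the correspondence for `GL₁` is local class field theory).  Kept out
of `LocalLanglandsGLOne` so that that file need not import `LocalLanglandsDatum`.

## References

* M. Harris, R. Taylor, *The geometry and cohomology of some simple Shimura varieties*, Ann. of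
  Math. Stud. 151 (2001), Thm. A (i). [HarrisTaylorAMS2001]
-/

noncomputable section

open scoped MatrixGroups

namespace Literature.NumberTheory.Automorphic

open Literature.NumberTheory.GaloisRepresentations
open Literature.NumberTheory.GaloisRepresentations.WeilDeligneRep

namespace LocalLanglandsDatum

variable {F : Type} [Field F] [ValuativeRel F] [TopologicalSpace F] [IsNonarchimedeanLocalField F]

/-- **The degree-one map of a local Langlands datum is local class field theory**: for every
`L : LocalLanglandsDatum F`, `L.recGL 1 = recGLOne L.hns L.artin`
(`IsLocalLanglandsGL.rec_one_eq_recGLOne`: clause `gl_one` pins `rec₁` on every class of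
`Irr(GL₁(F))`, each being a quasi-character `χ ∘ det`). [cite: HarrisTaylor2001, Thm A (i)] -/
theorem recGL_one_eq_recGLOne (L : LocalLanglandsDatum F) : L.recGL 1 = recGLOne L.hns L.artin :=
  L.isLocalLanglands.rec_one_eq_recGLOne

/-- The degree-zero map of a local Langlands datum is `recGLZero` (both sides are singletons).
[folklore] -/
theorem recGL_zero_eq_recGLZero (L : LocalLanglandsDatum F) : L.recGL 0 = recGLZero :=
  L.isLocalLanglands.rec_zero_eq_recGLZero

/-- For a datum `L` and an irreducible smooth representation `π` of `GL₁(F)` on which `GL₁(F)` acts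
through `χ ∘ det`: `L.recGL 1 [π] = [(χ ∘ artin, N = 0)]` (realised on `Fin 1 → ℂ`).
[cite: HarrisTaylor2001, Thm A (i)] -/
theorem recGL_one_mk (L : LocalLanglandsDatum F) {π : SmoothIrrep (GL (Fin 1) F)} {χ : QuasiChar F}
    (hχ : ∀ (g : GL (Fin 1) F) (v : π.V),
      π.ρ g v = ((χ (Matrix.GeneralLinearGroup.det g) : ℂˣ) : ℂ) • v) :
    L.recGL 1 (IrrClass.mk π) =
      Quotient.mk _ ⟨ofQuasiCharOn (Fin 1 → ℂ) L.hns L.artin χ,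
        isFrobSemisimple_ofQuasiCharOn L.hns L.artin χ⟩ :=
  L.isLocalLanglands.rec_one_mk hχ

/-- The quasi-character read off `L.recGL 1 [π]` is the quasi-character of `π`: if
`L.recGL 1 [π] = [(χ ∘ artin, 0)]` then `π = χ ∘ det`, i.e. `IrrClass.quasiChar [π] = χ`.
[cite: HarrisTaylor2001, Thm A (i)] -/
theorem quasiChar_eq_of_recGL_one_mk (L : LocalLanglandsDatum F) {π : SmoothIrrep (GL (Fin 1) F)}
    {χ : QuasiChar F}
    (h : L.recGL 1 (IrrClass.mk π) =
      Quotient.mk _ ⟨ofQuasiCharOn (Fin 1 → ℂ) L.hns L.artin χ,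
        isFrobSemisimple_ofQuasiCharOn L.hns L.artin χ⟩) :
    IrrClass.quasiChar (IrrClass.mk π) = χ := by
  rw [L.recGL_one_mk (IrrClass.quasiChar_spec π)] at h
  exact quasiChar_eq_of_isEquivalent_ofQuasiCharOn L.hns L.artin (Quotient.exact h)

end LocalLanglandsDatum

end Literature.NumberTheory.Automorphic

end
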